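import Summits.CriticalPhenomena.Ising3DConformalLimit.Theses.GaussianScaleMixture

/-!
# `stub_twistIdentities` of line `two-crystals-generate-so3` (crux `RotationUpgradeFromTwoPoint`,
stmt-CriticalPhenomena-8367) — kernel-checked verification by the deep-refute seat

The statement is copied VERBATIM from `Cruxes/RotationUpgradeFromTwoPoint/Lines/two-crystals-generate-so3.lean`
(gen 2, lead's reshape). Identity (2) is a pure ring identity (no relation between `√3, √5, √15` is
needed); identity (1) holds modulo `√15 = √3·√5`, `√5·√5⁻¹ = 1`, `√5⁻¹·√5⁻¹ = 1/5`, `√3·√3 = 3`, with the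
exact certificates computed by polynomial reduction (tools/twistcert.py in the refuter's folder).
Candidate proof for the worker holding the stub (refuters do not land positive statements).
-/

noncomputable section

open Literature.Probability.LatticeModels

namespace Summit.CriticalPhenomena.Ising3DConformalLimit.Cruxes.RotationUpgradeFromTwoPoint.DrefuteTwoCrystals

local notation "E3" => EuclideanSpace ℝ (Fin 3)

/-- The two explicit twist identities of the line `two-crystals-generate-so3`:
(1) `W R_z(θ₀) W = R_z(30°) R_x(90°) R_z(30°)` (the element `N` is the rotation by `θ₀ = arccos(-1/4)`
about `(2,0,1)/√5`); (2) `R_c (W R_z(φ) W) R_c⁻¹ = W R_x(φ) W` (the conjugate circle about `(-1,0,2)/√5`).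
[folklore] -/
theorem twistIdentities_holds :
  ∀ (W Rz30 Rx90 Rth Rc Rcinv : E3 → E3) (Rz Rx : ℝ → E3 → E3),
    (∀ x, W x = WithLp.toLp 2 ![(-x 0 + 2 * x 2) / Real.sqrt 5, -x 1, (2 * x 0 + x 2) / Real.sqrt 5]) →
    (∀ x, Rz30 x = WithLp.toLp 2
      ![Real.sqrt 3 / 2 * x 0 - x 1 / 2, x 0 / 2 + Real.sqrt 3 / 2 * x 1, x 2]) →
    (∀ x, Rx90 x = WithLp.toLp 2 ![x 0, -x 2, x 1]) →
    (∀ x, Rth x = WithLp.toLp 2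
      ![-(1 / 4) * x 0 - Real.sqrt 15 / 4 * x 1, Real.sqrt 15 / 4 * x 0 + -(1 / 4) * x 1, x 2]) →
    (∀ x, Rc x = WithLp.toLp 2 ![-x 2, x 1, x 0]) →
    (∀ x, Rcinv x = WithLp.toLp 2 ![x 2, x 1, -x 0]) →
    (∀ φ x, Rz φ x = WithLp.toLp 2
      ![Real.cos φ * x 0 - Real.sin φ * x 1, Real.sin φ * x 0 + Real.cos φ * x 1, x 2]) →
    (∀ φ x, Rx φ x = WithLp.toLp 2
      ![x 0, Real.cos φ * x 1 - Real.sin φ * x 2, Real.sin φ * x 1 + Real.cos φ * x 2]) →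
    (∀ x, W (Rth (W x)) = Rz30 (Rx90 (Rz30 x))) ∧
    (∀ φ x, Rc (W (Rz φ (W (Rcinv x)))) = W (Rx φ (W x))) := by
  intro W Rz30 Rx90 Rth Rc Rcinv Rz Rx hW hRz30 hRx90 hRth hRc hRcinv hRz hRx
  have h3 : Real.sqrt 3 * Real.sqrt 3 = 3 := Real.mul_self_sqrt (by norm_num)
  have h5 : Real.sqrt 5 * Real.sqrt 5 = 5 := Real.mul_self_sqrt (by norm_num)
  have h5ne : Real.sqrt 5 ≠ 0 := by positivity
  have hf : Real.sqrt 15 = Real.sqrt 3 * Real.sqrt 5 := by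
    rw [show (15:ℝ) = 3 * 5 by norm_num, Real.sqrt_mul (by norm_num) 5]
  have hbi : Real.sqrt 5 * (Real.sqrt 5)⁻¹ = 1 := mul_inv_cancel₀ h5ne
  have hii : (Real.sqrt 5)⁻¹ * (Real.sqrt 5)⁻¹ = 1 / 5 := by
    rw [← mul_inv, h5, one_div]
  constructor
  · intro x
    simp only [hW, hRth, hRz30, hRx90]
    ext j
    fin_cases j
    · simp
      linear_combination (((-1:ℝ)/4) * (Real.sqrt 5)⁻¹ * x 1) * hf + (((5:ℝ)/2) * x 2 + ((15:ℝ)/4) * x 0) * hii + (((-1:ℝ)/4) * Real.sqrt 3 * x 1) * hbi + (((-1:ℝ)/4) * x 0) * h3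
    · simp
      linear_combination (((-1:ℝ)/2) * (Real.sqrt 5)⁻¹ * x 2 + ((1:ℝ)/4) * (Real.sqrt 5)⁻¹ * x 0) * hf + (((-1:ℝ)/2) * Real.sqrt 3 * x 2 + ((1:ℝ)/4) * Real.sqrt 3 * x 0) * hbi
    · simp
      linear_combination (((1:ℝ)/2) * (Real.sqrt 5)⁻¹ * x 1) * hf + (((5:ℝ)/2) * x 0) * hii + (((1:ℝ)/2) * Real.sqrt 3 * x 1) * hbi
  · intro φ x
    simp only [hRcinv, hW, hRz, hRc, hRx]
    ext j
    fin_cases j <;> simp <;> ring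

end Summit.CriticalPhenomena.Ising3DConformalLimit.Cruxes.RotationUpgradeFromTwoPoint.DrefuteTwoCrystals

end
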